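import Mathlib.Topology.Algebra.MvPolynomial
import Mathlib.FieldTheory.IsAlgClosed.Basic
import Literature.Computability.AlgebraicComplexity.SchoenhageTau
import Literature.Computability.AlgebraicComplexity.OrbitClosureEuclidean
import HarnessLib

/-!
# Alder–Strassen: the secant variety `X_r` is the set of tensors of border rank `≤ r`

Topic `Computability/AlgebraicComplexity`. Vendored (work item wi-13446) for route
`MatrixMultiplication/FidelityWitnesses` (`WitnessCompleteness`, stmt-MatrixMultiplication-4962),
which wants, over `ℂ` and finite index types,
`closure {S | tensorRank S ≤ r} = {T | algBorderRank T ≤ r}` (Euclidean closure).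

## Source and what is vendored

Bürgisser–Clausen–Shokrollahi, *Algebraic Complexity Theory* (1997)
[BurgisserClausenShokrollahi1997], read: §15.4 Def. (15.19)–(15.20) (degeneration of order `q`,
border rank `R̲`, coordinate form `ε^{q-1} t + ε^q t' = Σ_{ρ≤r} u_ρ ⊗ v_ρ ⊗ w_ρ` over `k[ε]` — the
tree's `IsApproxDecomposition (q-1)`, `algBorderRank`, Bläser 2013 Def. 6.1), §20.1 (`S_r(f)` =
tensors of rank `≤ r` = image of the morphism `σ_r`; the secant variety `X_r(f)` := its Zariski
closure; **Thm. (20.3) (Alder)**: over an algebraically closed field, `X_r(f)` is irreducible and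
`X_r(f) = {t ∈ T(f) | R̲(t) ≤ r}`), Appendix 20.6 (Def. (20.22) topological degeneration,
**Thm. (20.24) (Strassen)** `⊴_top = ⊴`, of which (20.3) "is an immediate consequence"; proof by
curve selection, Lemmas (20.26)–(20.28)).

* `alder_secantVariety_eq_setOf_algBorderRank_le` — **named fact** (`def … : Prop`, D-0014): Thm.
  (20.3) without the irreducibility clause, for every algebraically closed field `K : Type` and
  finite index types, the Zariski closure being the tree's `zariskiClosure` (`OrbitClosure.lean`,
  `Z(I(S))`) transported along uncurrying (`tensorZariskiClosure A`).
* PROVED here (over `ℂ`): `tensorZariskiClosure_setOf_tensorRank_le_eq_closure` — the Zariski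
  closure of `S_r` equals its Euclidean closure. `⊇`: polynomials are continuous. `⊆`: `S_r` is the
  image of affine space under the polynomial map `secantParametrisation`
  (`range_secantParametrisation`, using that the infimum defining `tensorRank` is attained,
  `exists_eq_sum_triad_of_tensorRank_le`), and for images of complex affine spaces the Zariski
  closure lies in the classical closure — the tree's `mem_closure_range_of_ker_bind₁_le`
  (`OrbitClosureEuclidean`, density theorem SGA1 XII 2.2 / Mumford (2.33) + Chevalley), transported
  along the flattening homeomorphism `(ι → κ → μ → ℂ) ≃ₜ (ι × κ × μ → ℂ)`. This is Landsberg 2017,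
  Thm. 3.1.6.1 for `Z = S_r` [LandsbergGCT2017].
* Hence the wanted Euclidean form as a ONE-LINE consequence of the fact:
  `mem_closure_setOf_tensorRank_le_iff (h : alder…) : t ∈ closure {rank ≤ r} ↔ algBorderRank t ≤ r`
  and `closure_setOf_tensorRank_le_eq`.

## Not here

Irreducibility of `X_r(f)`; Thm. (20.24) for general pairs `s ⊴_top t` (orbit closures of a fixed
tensor: cf. `OrbitClosure*.lean` for forms); the elementary inclusion `{R̲ ≤ r} ⊆ X_r`
(`θ^{-h} Σ u_ρ(θ) ⊗ v_ρ(θ) ⊗ w_ρ(θ) → t`), which is part of the fact as stated and would be the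
first half of a discharge.
-/

noncomputable section

open scoped BigOperators Polynomial
open MvPolynomial

namespace Literature.Computability.AlgebraicComplexity

universe u v₁ v₂ v₃

section Flatten

variable {K : Type u} {ι : Type v₁} {κ : Type v₂} {μ : Type v₃}

/-- A `3`-tensor `t ∈ K^{ι × κ × μ}` (a curried function `ι → κ → μ → K`) as a function on the
index set `ι × κ × μ`, i.e. as a point of the affine space `K^{ι×κ×μ}` in which the Zariski
topology and polynomial functions live (BCS §20.1:
`T(f) = k^{f₁} ⊗ k^{f₂} ⊗ k^{f₃} ≅ k^{f₁ f₂ f₃}`). [folklore] -/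
def uncurryTensor (t : ι → κ → μ → K) : ι × κ × μ → K := fun x => t x.1 x.2.1 x.2.2

/-- Entries of the flattened tensor. [folklore] -/
@[simp] theorem uncurryTensor_apply (t : ι → κ → μ → K) (a : ι) (b : κ) (c : μ) :
    uncurryTensor t (a, b, c) = t a b c := rfl

/-- `uncurryTensor` is injective (it is a bijection with inverse currying). [folklore] -/
theorem uncurryTensor_injective : Function.Injective (uncurryTensor : (ι → κ → μ → K) → ι × κ × μ → K) :=
  fun s t h => funext fun a => funext fun b => funext fun c => by
    simpa using congrFun h (a, b, c)

/-- Flattening as a homeomorphism for the product topologies (currying twice, Mathlib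
`Homeomorph.piCurry`). [folklore] -/
def uncurryTensorHomeomorph [TopologicalSpace K] : (ι → κ → μ → K) ≃ₜ (ι × κ × μ → K) :=
  (Homeomorph.piCurry.trans (Homeomorph.piCongrRight fun _ : ι => Homeomorph.piCurry)).symm

/-- The flattening homeomorphism is `uncurryTensor`. [folklore] -/
@[simp] theorem coe_uncurryTensorHomeomorph [TopologicalSpace K] :
    ⇑(uncurryTensorHomeomorph : (ι → κ → μ → K) ≃ₜ (ι × κ × μ → K)) = uncurryTensor := rfl

end Flatten

section Zariski

variable {K : Type u} [Field K] {ι : Type v₁} {κ : Type v₂} {μ : Type v₃}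

/-- The **Zariski closure** of a set `A` of tensors in `K^{ι×κ×μ}`, transported from the tree's
`Literature.Computability.AlgebraicComplexity.zariskiClosure` on the affine space `ι × κ × μ → K`
(`OrbitClosure.lean`: `Z(I(S))`, the common zeros of the polynomials vanishing on `S`) along the
uncurrying `uncurryTensor` (BCS Ex. 4.16 / §20.1). [folklore] -/
def tensorZariskiClosure (A : Set (ι → κ → μ → K)) : Set (ι → κ → μ → K) :=
  uncurryTensor ⁻¹' zariskiClosure (uncurryTensor '' A)

/-- Membership in the Zariski closure: every polynomial in the `ι × κ × μ` coordinates vanishing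
on `A` vanishes at `t` (`mem_zariskiClosure_iff` of `OrbitClosure.lean`). [folklore] -/
theorem mem_tensorZariskiClosure_iff (A : Set (ι → κ → μ → K)) (t : ι → κ → μ → K) :
    t ∈ tensorZariskiClosure A ↔
      ∀ P : MvPolynomial (ι × κ × μ) K, (∀ s ∈ A, eval (uncurryTensor s) P = 0) →
        eval (uncurryTensor t) P = 0 := by
  simp only [tensorZariskiClosure, Set.mem_preimage, mem_zariskiClosure_iff, Set.forall_mem_image,
    aeval_eq_eval]

/-- `A` lies in its Zariski closure (`subset_zariskiClosure`). [folklore] -/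
theorem subset_tensorZariskiClosure (A : Set (ι → κ → μ → K)) : A ⊆ tensorZariskiClosure A :=
  fun _ ht => subset_zariskiClosure _ (Set.mem_image_of_mem _ ht)

/-- The Zariski closure is monotone (`zariskiClosure_mono`). [folklore] -/
theorem tensorZariskiClosure_mono {A B : Set (ι → κ → μ → K)} (h : A ⊆ B) :
    tensorZariskiClosure A ⊆ tensorZariskiClosure B :=
  Set.preimage_mono (zariskiClosure_mono (Set.image_mono h))

end Zariski

/-! ### The named fact -/

/-- **Alder's theorem** (BCS Thm. (20.3), attributed to Alder's 1984 thesis; an immediate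
consequence of Strassen's Thm. (20.24) "topological degeneration = degeneration", proved in BCS
Appendix 20.6 via curve selection, Lemma (20.28)). Over an algebraically closed field `k`, for a
format `f = (|ι|, |κ|, |μ|)`, the secant variety `X_r(f)` — the Zariski closure in
`T(f) = k^{ι×κ×μ}` of the set `S_r(f)` of tensors of rank `≤ r` — *consists of all tensors of border
rank at most `r`*:
`X_r(f) = {t ∈ T(f) | R̲(t) ≤ r}`. Here rank is `tensorRank` and border rank is the algebraic
(`ε`-degeneration) notion of BCS Def. (15.19)/(15.20), `t ⊴_q ⟨r⟩` iff
`ε^{q-1} t + ε^q t' = Σ_{ρ ≤ r} u_ρ ⊗ v_ρ ⊗ w_ρ` over `k[ε]`, which is the tree's `algBorderRank`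
(Bläser 2013 Def. 6.1, order `h = q - 1`). BCS also assert that `X_r(f)` is irreducible; that part
is not vendored. A named fact (`def … : Prop`, D-0014); the inclusion `⊇` is elementary, `⊆` is
the deep one. See `mem_closure_setOf_tensorRank_le_iff` for the Euclidean form over `ℂ`.
[cite: BurgisserClausenShokrollahi1997, Thm. (20.3) (Alder); Thm. (20.24), Appendix 20.6] -/
def alder_secantVariety_eq_setOf_algBorderRank_le : Prop :=
  ∀ {K : Type} [Field K] [IsAlgClosed K] {ι κ μ : Type} [Fintype ι] [Fintype κ] [Fintype μ]
    (r : ℕ),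
    tensorZariskiClosure {s : ι → κ → μ → K | tensorRank s ≤ r} =
      {t : ι → κ → μ → K | algBorderRank t ≤ r}

/-! ### Over `ℂ`: the Zariski closure of `S_r` is its Euclidean closure -/

section ComplexBasic

variable {ι κ μ : Type}

/-- Polynomials are continuous, so the Euclidean closure of any set of complex tensors lies in its
Zariski closure (Landsberg 2017, Thm. 3.1.6.1, first sentence).
[cite: LandsbergGCT2017, Thm. 3.1.6.1] -/
theorem closure_subset_tensorZariskiClosure (A : Set (ι → κ → μ → ℂ)) :
    closure A ⊆ tensorZariskiClosure A := by
  intro t ht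
  rw [mem_tensorZariskiClosure_iff]
  intro P hP
  have hcont : Continuous fun s : ι → κ → μ → ℂ => eval (uncurryTensor s) P :=
    (MvPolynomial.continuous_eval P).comp uncurryTensorHomeomorph.continuous
  have hclosed : IsClosed {s : ι → κ → μ → ℂ | eval (uncurryTensor s) P = 0} :=
    isClosed_eq hcont continuous_const
  exact (hclosed.closure_subset_iff.2 fun s hs => hP s hs) ht

variable (ι κ μ) in
/-- The parametrisation of `S_r`: source coordinates `(ρ, a) ↦ w_ρ(a)`, `(ρ, b) ↦ u_ρ(b)`,
`(ρ, c) ↦ v_ρ(c)`, target coordinate `(a, b, c) ↦ Σ_ρ w_ρ(a) u_ρ(b) v_ρ(c)` (BCS §20.1: `S_r(f)` is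
the image of the morphism `σ_r`). [cite: BurgisserClausenShokrollahi1997, §20.1 (σ_r)] -/
def secantParametrisation (r : ℕ) (x : ι × κ × μ) :
    MvPolynomial ((Fin r × ι) ⊕ ((Fin r × κ) ⊕ (Fin r × μ))) ℂ :=
  ∑ ρ : Fin r, X (Sum.inl (ρ, x.1)) * X (Sum.inr (Sum.inl (ρ, x.2.1))) *
    X (Sum.inr (Sum.inr (ρ, x.2.2)))

/-- Evaluating the parametrisation at a point gives the flattening of the corresponding sum of
`r` triads. [folklore] -/
theorem aeval_secantParametrisation (r : ℕ) (y : (Fin r × ι) ⊕ ((Fin r × κ) ⊕ (Fin r × μ)) → ℂ)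
    (x : ι × κ × μ) :
    aeval y (secantParametrisation ι κ μ r x) =
      uncurryTensor (∑ ρ : Fin r, triad (fun a => y (Sum.inl (ρ, a)))
        (fun b => y (Sum.inr (Sum.inl (ρ, b)))) (fun c => y (Sum.inr (Sum.inr (ρ, c))))) x := by
  obtain ⟨a, b, c⟩ := x
  simp only [secantParametrisation, map_sum, map_mul, aeval_X, uncurryTensor_apply, Finset.sum_apply,
    triad_apply]

end ComplexBasic

section Complex

variable {ι κ μ : Type} [Fintype ι] [Fintype κ] [Fintype μ]
  [DecidableEq ι] [DecidableEq κ] [DecidableEq μ]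

omit [Fintype ι] [Fintype κ] [Fintype μ] [DecidableEq ι] [DecidableEq κ] [DecidableEq μ] in
/-- A decomposition into `n` triads extends to one into `n + 1` triads (append a zero triad).
[folklore] -/
theorem eq_sum_triad_succ {K : Type u} [CommSemiring K] {t : ι → κ → μ → K} {n : ℕ}
    {w : Fin n → ι → K} {u : Fin n → κ → K} {v : Fin n → μ → K}
    (h : t = ∑ i, triad (w i) (u i) (v i)) :
    t = ∑ i : Fin (n + 1), triad (Fin.snoc (α := fun _ => ι → K) w 0 i)
      (Fin.snoc (α := fun _ => κ → K) u 0 i) (Fin.snoc (α := fun _ => μ → K) v 0 i) := by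
  rw [Fin.sum_univ_castSucc]
  simp only [Fin.snoc_castSucc, Fin.snoc_last]
  have h0 : triad (0 : ι → K) (0 : κ → K) (0 : μ → K) = 0 := by
    funext a b c; simp [triad_apply]
  rw [h0, add_zero]
  exact h

/-- **The standard decomposition**: over finite index types every tensor is the sum of the
`|ι|·|κ|·|μ|` triads `t_{abc} e_a ⊗ e_b ⊗ e_c`, indexed by `Fin (|ι|·|κ|·|μ|)`; in particular the
set defining `tensorRank t` is non-empty. [cite: Blaser2013, §4] -/
theorem exists_fin_eq_sum_triad {K : Type u} [CommSemiring K] (t : ι → κ → μ → K) :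
    ∃ (n : ℕ) (w : Fin n → ι → K) (u : Fin n → κ → K) (v : Fin n → μ → K),
      t = ∑ i, triad (w i) (u i) (v i) := by
  -- standard decomposition indexed by `ι × κ × μ`
  have hstd : t = ∑ p : ι × κ × μ, triad (Pi.single p.1 (t p.1 p.2.1 p.2.2))
      (Pi.single p.2.1 (1 : K)) (Pi.single p.2.2 (1 : K)) := by
    funext a b c
    rw [Finset.sum_apply, Finset.sum_apply, Finset.sum_apply]
    simp only [triad_apply]
    rw [Fintype.sum_eq_single (a, b, c)]
    · simp
    · rintro ⟨a', b', c'⟩ hne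
      by_cases ha : a' = a
      · subst ha
        by_cases hb : b' = b
        · subst hb
          have hc : c' ≠ c := fun hc => hne (by rw [hc])
          simp [Pi.single_eq_of_ne' hc]
        · simp [Pi.single_eq_of_ne' hb]
      · simp [Pi.single_eq_of_ne' ha]
  -- reindex by `Fin`
  set e := Fintype.equivFin (ι × κ × μ)
  refine ⟨Fintype.card (ι × κ × μ), fun i => Pi.single (e.symm i).1 (t (e.symm i).1 (e.symm i).2.1
    (e.symm i).2.2), fun i => Pi.single (e.symm i).2.1 1, fun i => Pi.single (e.symm i).2.2 1, ?_⟩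
  refine hstd.trans ?_
  exact Fintype.sum_equiv e _ _ fun p => by simp [e]

/-- A tensor of rank `≤ r` (finite index types) is a sum of exactly `r` triads: the infimum
defining `tensorRank` is attained (`exists_fin_eq_sum_triad`) and a shorter decomposition is
padded with zero triads. [cite: Blaser2013, §4] -/
theorem exists_eq_sum_triad_of_tensorRank_le {K : Type u} [CommSemiring K] {t : ι → κ → μ → K}
    {r : ℕ} (hr : tensorRank t ≤ r) :
    ∃ (w : Fin r → ι → K) (u : Fin r → κ → K) (v : Fin r → μ → K),
      t = ∑ i, triad (w i) (u i) (v i) := by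
  have hne : {r : ℕ | ∃ (w : Fin r → ι → K) (u : Fin r → κ → K) (v : Fin r → μ → K),
      t = ∑ i, triad (w i) (u i) (v i)}.Nonempty := by
    obtain ⟨n, w, u, v, h⟩ := exists_fin_eq_sum_triad t
    exact ⟨n, w, u, v, h⟩
  obtain ⟨w, u, v, huvw⟩ := Nat.sInf_mem hne
  obtain ⟨k, hk⟩ := Nat.exists_eq_add_of_le hr
  clear hr
  induction k generalizing r with
  | zero =>
    subst hk
    exact ⟨w, u, v, huvw⟩
  | succ k ih =>
    obtain ⟨w', u', v', h'⟩ := ih rfl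
    subst hk
    exact ⟨_, _, _, eq_sum_triad_succ h'⟩

/-- **The set `S_r` of tensors of rank `≤ r` is the image of the parametrisation** (BCS §20.1),
in flattened coordinates. [cite: BurgisserClausenShokrollahi1997, §20.1 (S_r(f) = im σ_r)] -/
theorem range_secantParametrisation (r : ℕ) :
    (Set.range fun (y : (Fin r × ι) ⊕ ((Fin r × κ) ⊕ (Fin r × μ)) → ℂ) (x : ι × κ × μ) =>
        aeval y (secantParametrisation ι κ μ r x)) =
      uncurryTensor '' {s : ι → κ → μ → ℂ | tensorRank s ≤ r} := by
  ext z
  simp only [Set.mem_range, Set.mem_image, Set.mem_setOf_eq]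
  constructor
  · rintro ⟨y, rfl⟩
    refine ⟨∑ ρ : Fin r, triad (fun a => y (Sum.inl (ρ, a))) (fun b => y (Sum.inr (Sum.inl (ρ, b))))
        (fun c => y (Sum.inr (Sum.inr (ρ, c)))), tensorRank_le_of_eq_sum _ _ _ rfl, ?_⟩
    funext x
    exact (aeval_secantParametrisation r y x).symm
  · rintro ⟨s, hs, rfl⟩
    obtain ⟨w, u, v, huvw⟩ := exists_eq_sum_triad_of_tensorRank_le hs
    refine ⟨Sum.elim (fun p => w p.1 p.2) (Sum.elim (fun p => u p.1 p.2) (fun p => v p.1 p.2)), ?_⟩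
    funext x
    rw [aeval_secantParametrisation, huvw]
    rfl

/-- **The Zariski closure of `S_r` lies in its Euclidean closure** (over `ℂ`): `S_r` is the image of
affine space under a polynomial map, hence irreducible and constructible (Chevalley), and for such
sets the two closures agree (density theorem; Mumford, *Complex projective varieties*, Thm. (2.33);
Landsberg 2017, Thm. 3.1.6.1) — here through the tree's coordinate form
`mem_closure_range_of_ker_bind₁_le`. [cite: LandsbergGCT2017, Thm. 3.1.6.1] -/
theorem tensorZariskiClosure_setOf_tensorRank_le_subset_closure (r : ℕ) :
    tensorZariskiClosure {s : ι → κ → μ → ℂ | tensorRank s ≤ r} ⊆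
      closure {s : ι → κ → μ → ℂ | tensorRank s ≤ r} := by
  intro t ht
  rw [mem_tensorZariskiClosure_iff] at ht
  -- every polynomial relation of the parametrisation vanishes at `uncurryTensor t`
  have hz : RingHom.ker (bind₁ (secantParametrisation ι κ μ r) :
        MvPolynomial (ι × κ × μ) ℂ →ₐ[ℂ]
          MvPolynomial ((Fin r × ι) ⊕ ((Fin r × κ) ⊕ (Fin r × μ))) ℂ) ≤
      RingHom.ker (aeval (uncurryTensor t) : MvPolynomial (ι × κ × μ) ℂ →ₐ[ℂ] ℂ) := by
    intro Q hQ
    rw [RingHom.mem_ker] at hQ ⊢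
    change aeval (uncurryTensor t) Q = 0
    rw [aeval_eq_eval]
    refine ht Q fun s hs => ?_
    have hmem : uncurryTensor s ∈ uncurryTensor '' {s : ι → κ → μ → ℂ | tensorRank s ≤ r} := ⟨s, hs, rfl⟩
    rw [← range_secantParametrisation] at hmem
    obtain ⟨y, hy⟩ := hmem
    rw [← aeval_eq_eval, ← hy]
    change aeval (fun x => aeval y (secantParametrisation ι κ μ r x)) Q = 0
    rw [← aeval_bind₁, hQ, map_zero]
  have hcl := mem_closure_range_of_ker_bind₁_le (secantParametrisation ι κ μ r) hz
  rw [range_secantParametrisation, ← coe_uncurryTensorHomeomorph, ← Homeomorph.image_closure] at hcl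
  obtain ⟨t', ht', htt'⟩ := hcl
  rwa [← uncurryTensorHomeomorph.injective htt']

/-- Over `ℂ` the Zariski closure of `S_r` (the secant variety `X_r`) is the Euclidean closure of
`S_r`. [cite: LandsbergGCT2017, Thm. 3.1.6.1] -/
theorem tensorZariskiClosure_setOf_tensorRank_le_eq_closure (r : ℕ) :
    tensorZariskiClosure {s : ι → κ → μ → ℂ | tensorRank s ≤ r} =
      closure {s : ι → κ → μ → ℂ | tensorRank s ≤ r} :=
  Set.Subset.antisymm (tensorZariskiClosure_setOf_tensorRank_le_subset_closure r)
    (closure_subset_tensorZariskiClosure _)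

/-- **Alder–Strassen over `ℂ`, Euclidean form** (the form wanted by route
`MatrixMultiplication/FidelityWitnesses`): a complex tensor is a limit of tensors of rank `≤ r`
iff its border rank is `≤ r`, `closure {S | R(S) ≤ r} = {T | R̲(T) ≤ r}` — from Alder's theorem
(the named fact `alder_secantVariety_eq_setOf_algBorderRank_le`, BCS Thm. (20.3)) and the equality
of Zariski and Euclidean closures of `S_r` proved above.
[cite: BurgisserClausenShokrollahi1997, Thm. (20.3) with §15.4 (introductory paragraph, k = ℂ)] -/
theorem mem_closure_setOf_tensorRank_le_iff (h : alder_secantVariety_eq_setOf_algBorderRank_le)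
    (r : ℕ) (t : ι → κ → μ → ℂ) :
    t ∈ closure {s : ι → κ → μ → ℂ | tensorRank s ≤ r} ↔ algBorderRank t ≤ r := by
  rw [← tensorZariskiClosure_setOf_tensorRank_le_eq_closure, h r]
  rfl

/-- Set form of `mem_closure_setOf_tensorRank_le_iff`.
[cite: BurgisserClausenShokrollahi1997, Thm. (20.3)] -/
theorem closure_setOf_tensorRank_le_eq (h : alder_secantVariety_eq_setOf_algBorderRank_le) (r : ℕ) :
    closure {s : ι → κ → μ → ℂ | tensorRank s ≤ r} = {t : ι → κ → μ → ℂ | algBorderRank t ≤ r} := by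
  rw [← tensorZariskiClosure_setOf_tensorRank_le_eq_closure, h r]

end Complex

end Literature.Computability.AlgebraicComplexity
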